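import Mathlib
import Summits.ValiantsHypothesis.ValiantsHypothesis.Theses.BarrierLever
import Literature.Computability.AlgebraicComplexity.ArithCircuitProofs
import Literature.Computability.AlgebraicComplexity.IMMInVPProofs
import Summits.ValiantsHypothesis.ValiantsHypothesis.Theorems.BarrierLeverDefinableEquationsDegreeLowerBound
import Summits.ValiantsHypothesis.ValiantsHypothesis.Theorems.BarrierLeverDefinableEquationsStatus
import Summits.ValiantsHypothesis.ValiantsHypothesis.Theorems.CirculantFourierTargetImpliesSensitive
import Summits.ValiantsHypothesis.ValiantsHypothesis.Theorems.CirculantFourierRealForms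

/-!
# Crux `BarrierLever.DefinableEquations` (stmt-ValiantsHypothesis-8745) — tests at `b = 2` (lead c4)

Cheap members of `SmallCircuits ℂ n 2`, i.e. points at whose coefficient vectors EVERY equation
against size-`n²` circuits — in particular the boolean sum of any `DefinableEquations` witness at
`b = 2`, where the open part of the crux begins (`definableEquations_of_ge_two`) — must vanish:

* `sparse_mem_smallCircuits` — every polynomial with `≤ s` monomials of degree `≤ k ≤ n` and
  `s (2k + 2) ≤ n ^ b` (support statistics die; instances: `∑ xᵢ³` (`rungOne_fails_at_two`), the
  symmetrised matrix-multiplication cubic `tr(X³)` on `n = m²` variables with `8 m³ ≤ m⁴`, any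
  `n²/8`-sparse cubic — whence the degree bound `> n²/8 - 1` for cubic-window equations,
  `Status.lt_card_support_of_vanishes_on_window`);
* `sumProdLinear_mem_smallCircuits_two` — sums of `r` products of three linear forms with
  `r (6n + 3) ≤ n²` (secants `σ_r(Chow₃(ℂⁿ))`, `r = Ω(n)`: low-order flattenings die);
* `sumSqPow_mem_smallCircuits_two` — `(∑ xᵢ²)^(n/2)` (nonsingular middle catalecticant: every
  symmetric-flattening minor dies), sharing the quadric via the substitution bound
  `complexity_aeval_le`.

Elementary size bookkeeping over the tree's `complexity`; no new definitions, no named facts.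
-/

set_option linter.dupNamespace false

noncomputable section

namespace Summit.ValiantsHypothesis.ValiantsHypothesis.Theorems.BarrierLeverDefinableEquations

open MvPolynomial
open Literature.Computability.AlgebraicComplexity Literature.Barriers.ValiantsHypothesis
open Summit.ValiantsHypothesis.ValiantsHypothesis.Theses.BarrierLever
open scoped BigOperators

namespace Status

/-! ## Tests every witness at `b = 2` must pass (cheap members of `SmallCircuits ℂ n 2`)

Any equation against `SmallCircuits ℂ n 2` — in particular the boolean sum of a `DefinableEquations`
witness at `b = 2`, where the open part of the crux begins (`definableEquations_of_ge_two`) —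
vanishes at the coefficient vector of each of the following polynomials.  Together they defeat every
classical equation family: sparse polynomials (support statistics; e.g. `∑ xᵢ³`, the symmetrised
matrix-multiplication cubic `tr(X³)` with `m³ ≤ m⁴/8` monomials), sums of `Ω(n)` products of three
linear forms (secants of the Chow variety: low-order flattenings), and the power `(∑ xᵢ²)^(n/2)`
(full middle catalecticant rank: all symmetric flattenings). -/

/-- **Sparse polynomials are small circuits.**  A polynomial with `≤ s` monomials of degree `≤ k ≤ n`
lies in `SmallCircuits ℂ n b` as soon as `s (2k + 2) ≤ n ^ b`. [folklore] -/
theorem sparse_mem_smallCircuits {n k b : ℕ} {M : Set (Fin n →₀ ℕ)} (hM : ∀ m ∈ M, m.degree ≤ k)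
    (hk : k ≤ n) (S : Finset M) (v : M → ℂ) (hS : S.card * (2 * k + 2) ≤ n ^ b) :
    (∑ e ∈ S, monomial (e : Fin n →₀ ℕ) (v e) : MvPolynomial (Fin n) ℂ) ∈ SmallCircuits ℂ n b :=
  ⟨(totalDegree_sparse_le hM S v).trans hk, (complexity_sparse_le hM S v).trans hS⟩

/-- **Secants of the Chow variety are small circuits.**  A sum of `r` products of three linear forms
(Chow rank `≤ r`) lies in `SmallCircuits ℂ n 2` whenever `r (6n + 3) ≤ n²` and `n ≥ 3` — e.g.
`r = ⌊n / 7⌋ - 1`.  So every equation at `b = 2` vanishes on `σ_r(Chow₃(ℂⁿ))` with `r = Ω(n)`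
(and likewise for products of more factors). [folklore] -/
theorem sumProdLinear_mem_smallCircuits_two {n r : ℕ} (hn : 3 ≤ n) (hr : r * (6 * n + 3) ≤ n ^ 2)
    (a b c : Fin r → Fin n → ℂ) :
    (∑ j : Fin r, (∑ i : Fin n, C (a j i) * (X i : MvPolynomial (Fin n) ℂ)) *
        (∑ i : Fin n, C (b j i) * (X i : MvPolynomial (Fin n) ℂ)) *
        (∑ i : Fin n, C (c j i) * (X i : MvPolynomial (Fin n) ℂ))) ∈ SmallCircuits ℂ n 2 := by
  refine ⟨?_, ?_⟩
  · refine (MvPolynomial.totalDegree_finsetSum_le fun j _ => ?_).trans hn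
    have h1 := MvPolynomial.totalDegree_mul
      ((∑ i : Fin n, C (a j i) * (X i : MvPolynomial (Fin n) ℂ)) *
        (∑ i : Fin n, C (b j i) * (X i : MvPolynomial (Fin n) ℂ)))
      (∑ i : Fin n, C (c j i) * (X i : MvPolynomial (Fin n) ℂ))
    have h2 := MvPolynomial.totalDegree_mul (∑ i : Fin n, C (a j i) * (X i : MvPolynomial (Fin n) ℂ))
      (∑ i : Fin n, C (b j i) * (X i : MvPolynomial (Fin n) ℂ))
    have ha := Summit.ValiantsHypothesis.ValiantsHypothesis.Theorems.RealForms.totalDegree_linform_le (a j)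
    have hb := Summit.ValiantsHypothesis.ValiantsHypothesis.Theorems.RealForms.totalDegree_linform_le (b j)
    have hc := Summit.ValiantsHypothesis.ValiantsHypothesis.Theorems.RealForms.totalDegree_linform_le (c j)
    omega
  · have hterm : ∀ j : Fin r,
        complexity ((∑ i : Fin n, C (a j i) * (X i : MvPolynomial (Fin n) ℂ)) *
          (∑ i : Fin n, C (b j i) * (X i : MvPolynomial (Fin n) ℂ)) *
          (∑ i : Fin n, C (c j i) * (X i : MvPolynomial (Fin n) ℂ))) ≤ 6 * n + 2 := by
      intro j
      calc _ ≤ complexity ((∑ i : Fin n, C (a j i) * (X i : MvPolynomial (Fin n) ℂ)) *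
                (∑ i : Fin n, C (b j i) * (X i : MvPolynomial (Fin n) ℂ))) +
              complexity (∑ i : Fin n, C (c j i) * (X i : MvPolynomial (Fin n) ℂ)) + 1 :=
            complexity_mul_le_holds _ _
        _ ≤ (complexity (∑ i : Fin n, C (a j i) * (X i : MvPolynomial (Fin n) ℂ)) +
              complexity (∑ i : Fin n, C (b j i) * (X i : MvPolynomial (Fin n) ℂ)) + 1) +
              complexity (∑ i : Fin n, C (c j i) * (X i : MvPolynomial (Fin n) ℂ)) + 1 := by
            gcongr
            exact complexity_mul_le_holds _ _
        _ ≤ (2 * n + 2 * n + 1) + 2 * n + 1 := by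
            gcongr <;> exact Summit.ValiantsHypothesis.ValiantsHypothesis.Theorems.CirculantFourierTargetImpliesSensitive.complexity_linearForm_le _
        _ = 6 * n + 2 := by ring
    refine (complexity_finset_sum_le _ _).trans ?_
    have hsum : ∑ j : Fin r, complexity ((∑ i : Fin n, C (a j i) * (X i : MvPolynomial (Fin n) ℂ)) *
          (∑ i : Fin n, C (b j i) * (X i : MvPolynomial (Fin n) ℂ)) *
          (∑ i : Fin n, C (c j i) * (X i : MvPolynomial (Fin n) ℂ))) ≤ ∑ _j : Fin r, (6 * n + 2) :=
      Finset.sum_le_sum fun j _ => hterm j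
    simp only [Finset.sum_const, Finset.card_univ, Fintype.card_fin, smul_eq_mul] at hsum ⊢
    calc _ ≤ r * (6 * n + 2) + r := by omega
      _ = r * (6 * n + 3) := by ring
      _ ≤ n ^ 2 := hr

/-- **The power of the sum of squares is a small circuit.**  `(∑ᵢ xᵢ²)^(n/2) ∈ SmallCircuits ℂ n 2`
for `n ≥ 3`: the quadric costs `≤ 2n` gates and the power `n/2` more (substitution into `X^(n/2)`,
`complexity_aeval_le` — sharing the quadric), `2n + n/2 ≤ n²`.  Its middle catalecticant is
nonsingular, so no symmetric-flattening minor survives `b = 2`. [folklore] -/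
theorem sumSqPow_mem_smallCircuits_two {n : ℕ} (hn : 3 ≤ n) :
    (∑ i : Fin n, (X i : MvPolynomial (Fin n) ℂ) * X i) ^ (n / 2) ∈ SmallCircuits ℂ n 2 := by
  set q : MvPolynomial (Fin n) ℂ := ∑ i : Fin n, (X i : MvPolynomial (Fin n) ℂ) * X i with hq
  refine ⟨?_, ?_⟩
  · calc (q ^ (n / 2)).totalDegree ≤ (n / 2) * q.totalDegree := MvPolynomial.totalDegree_pow _ _
      _ ≤ (n / 2) * 2 := by
          gcongr
          refine MvPolynomial.totalDegree_finsetSum_le fun i _ => ?_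
          calc ((X i : MvPolynomial (Fin n) ℂ) * X i).totalDegree
              ≤ (X i : MvPolynomial (Fin n) ℂ).totalDegree + (X i : MvPolynomial (Fin n) ℂ).totalDegree :=
                MvPolynomial.totalDegree_mul _ _
            _ = 1 + 1 := by rw [MvPolynomial.totalDegree_X]
            _ = 2 := rfl
      _ ≤ n := Nat.div_mul_le_self n 2
  · have hqc : complexity q ≤ 2 * n := by
      have h1 : ∑ i : Fin n, complexity ((X i : MvPolynomial (Fin n) ℂ) * X i) ≤ ∑ _i : Fin n, 1 := by
        refine Finset.sum_le_sum fun i _ => ?_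
        calc complexity ((X i : MvPolynomial (Fin n) ℂ) * X i)
            ≤ complexity (X i : MvPolynomial (Fin n) ℂ) + complexity (X i : MvPolynomial (Fin n) ℂ) + 1 :=
              complexity_mul_le_holds _ _
          _ = 1 := by rw [complexity_X_holds]
      have h2 := complexity_finset_sum_le (Finset.univ : Finset (Fin n))
        (fun i => (X i : MvPolynomial (Fin n) ℂ) * X i)
      simp only [Finset.sum_const, Finset.card_univ, Fintype.card_fin, smul_eq_mul, mul_one] at h1 h2
      rw [hq]
      omega
    -- share the quadric: `q ^ j = aeval (fun _ => q) (X 0 ^ j)`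
    have hsub : q ^ (n / 2) = aeval (fun _ : Fin 1 => q) ((X 0 : MvPolynomial (Fin 1) ℂ) ^ (n / 2)) := by
      rw [map_pow, aeval_X]
    rw [hsub]
    calc complexity (aeval (fun _ : Fin 1 => q) ((X 0 : MvPolynomial (Fin 1) ℂ) ^ (n / 2)))
        ≤ complexity ((X 0 : MvPolynomial (Fin 1) ℂ) ^ (n / 2)) + ∑ _i : Fin 1, complexity q :=
          complexity_aeval_le _ _
      _ ≤ n / 2 + 2 * n := by
          rw [Finset.sum_const, Finset.card_univ, Fintype.card_fin, smul_eq_mul, one_mul]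
          gcongr
          exact DegreeLowerBound.complexity_X_pow_le (0 : Fin 1) (n / 2)
      _ ≤ n ^ 2 := by nlinarith [Nat.div_mul_le_self n 2]

end Status

/-! ## Registered sub-goal (signature verbatim as registered on stmt-ValiantsHypothesis-8745) -/

/-- **Registered sub-goal** `sumSqPow_mem_smallCircuits_two`: `(∑ xᵢ²)^(n/2)` is a degree-`≤ n`
polynomial of size `≤ n²` for `n ≥ 3` — the catalecticant killer lies in the class at `b = 2`, so every
equation at `b = 2` vanishes at its coefficient vector. [folklore] -/
theorem sumSqPow_mem_smallCircuits_two :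
    ∀ n : ℕ, 3 ≤ n → (∑ i : Fin n, (MvPolynomial.X i : MvPolynomial (Fin n) ℂ) * MvPolynomial.X i) ^ (n / 2) ∈ Literature.Barriers.ValiantsHypothesis.SmallCircuits ℂ n 2 :=
  fun _ hn => Status.sumSqPow_mem_smallCircuits_two hn

end Summit.ValiantsHypothesis.ValiantsHypothesis.Theorems.BarrierLeverDefinableEquations

end
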